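import Mathlib
import Literature.MathematicalPhysics.QuantumLattice.BdGBondHamiltonianTorus
import Literature.MathematicalPhysics.QuantumLattice.HubbardModel

/-!
# Translates of a block on the torus: site and bond multiplicities, and the hopping term in
# unit-step form

Topic `MathematicalPhysics/QuantumLattice` (family `hubbard`). Bookkeeping for LOCAL (block)
decompositions of translation-invariant sums on the discrete torus `(ℤ/Lℤ)²`: the blocks are the
translates `a + [0,R)²`, `a ∈ (ℤ/Lℤ)²`, of the offsets `u : Fin 2 → Fin R` (embedded as
`u ↦ (u_i mod L)_i`).

* `sum_sum_translate` — every site lies in `R²` translates: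
  `Σ_a Σ_u G(a + u) = R² · Σ_x G(x)`;
* `sum_sum_ite_translate` — with a constraint on the offset: `Σ_a Σ_u [P u] G(a + u) = #{u | P u} · Σ_x G(x)`;
* `card_filter_exists_translate_single` / `…_neg_single` — the INNER-bond multiplicity: the offsets
  `u` with `u ± e_i ∈ [0,R)²` number exactly `R(R-1)`; hence (`sum_sum_ite_exists_translate`) every
  nearest-neighbour bond of the torus is an inner bond of exactly `R(R-1)` translates;
* `hoppingSum_eq_sum_unitSteps` — the hopping term of `hubbardTorus 2 L t U` in unit-step form
  (`L ≥ 3`): `Σ_{X~Y,σ} c†_{Xσ}c_{Yσ} = Σ_x Σ_{e ∈ unitSteps} Σ_σ c†_{xσ} c_{x+e,σ}` (re-proved here;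
  the tree's copy in `PairingChannelIdentitiesZhangProofs` is private);
* `hubbardTorus_eq_unitSteps` — hence `hubbardTorus 2 L t U = -t Σ_x Σ_e Σ_σ c†_{xσ}c_{x+e,σ} + U Σ_X n_{X↑}n_{X↓}`.

References: D. Ruelle, *Statistical Mechanics: Rigorous Results* (1969) §2.2 (boxes and
translates); S. Friedli, Y. Velenik (2017) §3.1 (the torus graph); folklore. No definition and no
named fact is introduced.
-/

namespace Literature.MathematicalPhysics.QuantumLattice

open Finset Literature.Probability.LatticeModels

noncomputable section

variable {L : ℕ} [NeZero L]

/-! ### Site multiplicities -/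

/-- Every site lies in `R²` translates of the block: `Σ_a Σ_{u ∈ [0,R)²} G(a + u) = R² Σ_x G(x)`.
[folklore] -/
theorem sum_sum_translate {M : Type*} [AddCommMonoid M] (R : ℕ) (G : TorusSite 2 L → M) :
    ∑ a : TorusSite 2 L, ∑ u : Fin 2 → Fin R, G (a + fun i => ((u i : ℕ) : ZMod L)) =
      (R ^ 2) • ∑ x : TorusSite 2 L, G x := by
  rw [Finset.sum_comm]
  have h : ∀ u : Fin 2 → Fin R, ∑ a : TorusSite 2 L, G (a + fun i => ((u i : ℕ) : ZMod L)) =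
      ∑ x : TorusSite 2 L, G x := fun u =>
    Fintype.sum_equiv (Equiv.addRight fun i => ((u i : ℕ) : ZMod L)) _ _ fun a => rfl
  simp only [h, Finset.sum_const, Finset.card_univ, Fintype.card_fun, Fintype.card_fin]

/-- With a constraint on the offset: `Σ_a Σ_u [P u] G(a + u) = #{u | P u} · Σ_x G(x)`. [folklore] -/
theorem sum_sum_ite_translate {M : Type*} [AddCommMonoid M] (R : ℕ) (P : (Fin 2 → Fin R) → Prop)
    [DecidablePred P] (G : TorusSite 2 L → M) :
    ∑ a : TorusSite 2 L, ∑ u : Fin 2 → Fin R,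
        (if P u then G (a + fun i => ((u i : ℕ) : ZMod L)) else 0) =
      (Finset.univ.filter P).card • ∑ x : TorusSite 2 L, G x := by
  rw [Finset.sum_comm]
  have h : ∀ u : Fin 2 → Fin R, ∑ a : TorusSite 2 L,
      (if P u then G (a + fun i => ((u i : ℕ) : ZMod L)) else 0) =
      if P u then ∑ x : TorusSite 2 L, G x else 0 := by
    intro u
    split_ifs with hu
    · exact Fintype.sum_equiv (Equiv.addRight fun i => ((u i : ℕ) : ZMod L)) _ _ fun a => rfl
    · exact Finset.sum_const_zero
  simp only [h]
  rw [← Finset.sum_filter, Finset.sum_const]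

/-! ### Inner-bond multiplicities -/

/-- The offsets `u ∈ [0,R)²` with `u + e_i ∈ [0,R)²` are those with `u_i + 1 < R`. [folklore] -/
theorem exists_translate_single_iff {R : ℕ} (u : Fin 2 → Fin R) (i : Fin 2) :
    (∃ v : Fin 2 → Fin R, ∀ i', ((v i' : ℕ) : ℤ) = ((u i' : ℕ) : ℤ) + (Pi.single i (1 : ℤ) : Site 2) i') ↔
      (u i : ℕ) + 1 < R := by
  constructor
  · rintro ⟨v, hv⟩
    have h := hv i
    rw [Pi.single_eq_same] at h
    have := (v i).isLt
    omega
  · intro h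
    refine ⟨Function.update u i ⟨(u i : ℕ) + 1, h⟩, fun i' => ?_⟩
    by_cases hi' : i' = i
    · subst hi'; simp
    · rw [Function.update_of_ne hi', Pi.single_eq_of_ne hi', add_zero]

/-- The offsets `u ∈ [0,R)²` with `u - e_i ∈ [0,R)²` are those with `1 ≤ u_i`. [folklore] -/
theorem exists_translate_neg_single_iff {R : ℕ} (u : Fin 2 → Fin R) (i : Fin 2) :
    (∃ v : Fin 2 → Fin R, ∀ i', ((v i' : ℕ) : ℤ) = ((u i' : ℕ) : ℤ) + (-(Pi.single i (1 : ℤ) : Site 2)) i') ↔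
      1 ≤ (u i : ℕ) := by
  constructor
  · rintro ⟨v, hv⟩
    have h := hv i
    rw [Pi.neg_apply, Pi.single_eq_same] at h
    omega
  · intro h
    refine ⟨Function.update u i ⟨(u i : ℕ) - 1, by have := (u i).isLt; omega⟩, fun i' => ?_⟩
    by_cases hi' : i' = i
    · subst hi'
      simp only [Function.update_self, Pi.neg_apply, Pi.single_eq_same]
      push_cast [Nat.cast_sub h]
      ring
    · rw [Function.update_of_ne hi', Pi.neg_apply, Pi.single_eq_of_ne hi', neg_zero, add_zero]

/-- Counting one coordinate: `#{a ∈ [0,R) | a + 1 < R} = R - 1`, as the sum of an indicator.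
[folklore] -/
theorem sum_ite_succ_lt (R : ℕ) :
    ∑ a : Fin R, (if (a : ℕ) + 1 < R then (1 : ℕ) else 0) = R - 1 := by
  rcases Nat.eq_zero_or_pos R with rfl | hR
  · simp
  · obtain ⟨S, rfl⟩ : ∃ S, R = S + 1 := ⟨R - 1, by omega⟩
    rw [Fin.sum_univ_eq_sum_range (fun k => if k + 1 < S + 1 then (1 : ℕ) else 0) (S + 1),
      Finset.sum_range_succ, if_neg (by omega), add_zero, Nat.add_sub_cancel]
    rw [Finset.sum_congr rfl fun k hk => if_pos (by simp at hk; omega)]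
    simp

/-- Counting one coordinate: `#{a ∈ [0,R) | 1 ≤ a} = R - 1`, as the sum of an indicator. [folklore] -/
theorem sum_ite_one_le (R : ℕ) :
    ∑ a : Fin R, (if 1 ≤ (a : ℕ) then (1 : ℕ) else 0) = R - 1 := by
  rcases Nat.eq_zero_or_pos R with rfl | hR
  · simp
  · obtain ⟨S, rfl⟩ : ∃ S, R = S + 1 := ⟨R - 1, by omega⟩
    rw [Fin.sum_univ_eq_sum_range (fun k => if 1 ≤ k then (1 : ℕ) else 0) (S + 1),
      Finset.sum_range_succ', if_neg (by omega), add_zero, Nat.add_sub_cancel]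
    rw [Finset.sum_congr rfl fun k _ => if_pos (by omega)]
    simp

/-- A product count on `Fin 2 → Fin R`: if `P u` only constrains the coordinate `i` through `Q`,
then `#{u | P u} = R · #{a | Q a}`. [folklore] -/
theorem card_filter_coord (R : ℕ) (i : Fin 2) (Q : Fin R → Prop) [DecidablePred Q]
    (P : (Fin 2 → Fin R) → Prop) [DecidablePred P] (hPQ : ∀ u, P u ↔ Q (u i)) :
    (Finset.univ.filter P).card = R * (Finset.univ.filter Q).card := by
  classical
  set e : (Fin 2 → Fin R) ≃ Fin R × Fin R := piFinTwoEquiv fun _ => Fin R with he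
  have hP : Finset.univ.filter P = Finset.univ.filter fun u : Fin 2 → Fin R => Q (u i) :=
    Finset.filter_congr fun u _ => hPQ u
  rw [hP, ← Finset.card_map e.toEmbedding]
  fin_cases i
  · have hmap : (Finset.univ.filter fun u : Fin 2 → Fin R => Q (u 0)).map e.toEmbedding =
        (Finset.univ.filter Q) ×ˢ (Finset.univ : Finset (Fin R)) := by
      ext ⟨a, b⟩
      rw [Finset.mem_map_equiv, Finset.mem_filter, Finset.mem_product, Finset.mem_filter]
      simp [he]
    simp only [Fin.zero_eta] at hmap ⊢
    rw [hmap, Finset.card_product, Finset.card_univ, Fintype.card_fin, mul_comm]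
  · have hmap : (Finset.univ.filter fun u : Fin 2 → Fin R => Q (u 1)).map e.toEmbedding =
        (Finset.univ : Finset (Fin R)) ×ˢ (Finset.univ.filter Q) := by
      ext ⟨a, b⟩
      rw [Finset.mem_map_equiv, Finset.mem_filter, Finset.mem_product, Finset.mem_filter]
      simp [he]
    simp only [Fin.mk_one] at hmap ⊢
    rw [hmap, Finset.card_product, Finset.card_univ, Fintype.card_fin]

/-- **Inner-bond multiplicity, forward step**: `#{u ∈ [0,R)² | u + e_i ∈ [0,R)²} = R(R-1)`. [folklore] -/
theorem card_filter_exists_translate_single (R : ℕ) (i : Fin 2) :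
    (Finset.univ.filter fun u : Fin 2 → Fin R =>
        ∃ v : Fin 2 → Fin R, ∀ i', ((v i' : ℕ) : ℤ) = ((u i' : ℕ) : ℤ) + (Pi.single i (1 : ℤ) : Site 2) i').card =
      R * (R - 1) := by
  classical
  rw [card_filter_coord R i (fun a : Fin R => (a : ℕ) + 1 < R) _
    (fun u => exists_translate_single_iff u i), Finset.card_filter, sum_ite_succ_lt]

/-- **Inner-bond multiplicity, backward step**: `#{u ∈ [0,R)² | u - e_i ∈ [0,R)²} = R(R-1)`. [folklore] -/
theorem card_filter_exists_translate_neg_single (R : ℕ) (i : Fin 2) :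
    (Finset.univ.filter fun u : Fin 2 → Fin R =>
        ∃ v : Fin 2 → Fin R, ∀ i', ((v i' : ℕ) : ℤ) = ((u i' : ℕ) : ℤ) + (-(Pi.single i (1 : ℤ) : Site 2)) i').card =
      R * (R - 1) := by
  classical
  rw [card_filter_coord R i (fun a : Fin R => 1 ≤ (a : ℕ)) _
    (fun u => exists_translate_neg_single_iff u i), Finset.card_filter, sum_ite_one_le]

/-- **Every unit step is an inner step of exactly `R(R-1)` translates**: for `e ∈ unitSteps`,
`Σ_a Σ_u [u + e ∈ [0,R)²] G(a + u) = R(R-1) · Σ_x G(x)`. [folklore] -/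
theorem sum_sum_ite_exists_translate {M : Type*} [AddCommMonoid M] (R : ℕ) {e : Site 2}
    (he : e ∈ unitSteps) (G : TorusSite 2 L → M) :
    ∑ a : TorusSite 2 L, ∑ u : Fin 2 → Fin R,
        (if (∃ v : Fin 2 → Fin R, ∀ i', ((v i' : ℕ) : ℤ) = ((u i' : ℕ) : ℤ) + e i')
          then G (a + fun i => ((u i : ℕ) : ZMod L)) else 0) =
      (R * (R - 1)) • ∑ x : TorusSite 2 L, G x := by
  classical
  rw [sum_sum_ite_translate]
  congr 1
  simp only [unitSteps, Finset.mem_insert, Finset.mem_singleton] at he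
  rcases he with rfl | rfl | rfl | rfl
  · exact card_filter_exists_translate_single R 0
  · exact card_filter_exists_translate_neg_single R 0
  · exact card_filter_exists_translate_single R 1
  · exact card_filter_exists_translate_neg_single R 1

end

end Literature.MathematicalPhysics.QuantumLattice
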